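/-
Copyright (c) 2026. All rights reserved.
Released under Apache 2.0 license as described in the file LICENSE.
Authors: abc-iut cell, seat abc-iut-rh-typ-4 (gen 9).
-/
import Summits.ABC.IUTFork.Repair.RHCellSlackExactOrders
import Summits.ABC.IUTFork.Conditional.HexHullThresholdGenuine
import Literature.IUT.LogVolume.TensorPacketLicenceCellTieFree
import Literature.IUT.LogVolume.DifferentEstimatesCorollaries
import Literature.IUT.LogVolume.FundamentalIdentity
import HarnessLib

/-!
# IUT REPAIR branch → R-H (D-0079), door «G2-CREDIT±» part 4 — THE RADII AUDIT DISCHARGED: the diagonal cell slack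
# with NO lattice binder left (sign law at EVERY place; closed-form value at tie-free places)

PROOF-ONLY sequel (D-0012: 0 definitions, 0 `Prop` facts, no instance, no notation) of `Repair/RHCellSlackExact` (p481438),
`Repair/RHCellSlackExactStatement` (p482070) and `Repair/RHCellSlackExactOrders` (p483291), abc-iut cell, rung LADDER-ABC:A2.RESCUE.H,
seat abc-iut-rh-typ-4 (gen 9). TAKES NO SIDE on [IUTchIII] Cor. 3.12 (S. Mochizuki, *Inter-universal Teichmüller theory III*, kurims
manuscript, Cor. 3.12 p. 173–175; Thm. 3.11 (i) (Ind1)(Ind2) p. 154; [IUTchIV] Prop. 1.1 p. 9, Prop. 1.2 (i)(ii) p. 10) or on any author: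
classical lattice arithmetic over the cell's REAL definitions (`PacketAlgebra`, `normalizedPacket = (R_I)^∼`, `logPacket = log_p(R_I^×)`,
`packetHull`, `indTwo`, `packetLogμ = log μ̄`). typed ≠ proved for anything not named as a theorem; instantiated ≠ endorsed.

WHY (R-H lead ruling D-0121 R33 (c) 2026-08-27T03:03:18Z, «RADII-AUDIT»: the one residual named by abc-iut-rh2-T-1 on the reading «surplus =
slack» of part 1 — that the integer columns `(δ, R_in, R_out, m_q)` of the R-H / R-W tables ARE the kernel binders of `cellSlack_diag_orders`).
Part 3 computes the cell slack of the DIAGONAL packet of one local field `K/ℚ_p` in integer orders, but under SIX lattice binders: an inner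
radius `c_in` (`hin`/`hmax`/`hRin`), an outer radius `c_out` (`houtΛ`/`hdom`/`hRout`) and a different exponent `D` (`hD`). THIS file
discharges them BY NAME from landed local-field theorems, leaving only the data `(ϖ, x, M, t_q, m_q)`:

* §1 `exists_radii_binders` — at EVERY `p`-adic field the six binders are INHABITED for some integers `R_in, R_out` (this lineage's
  `HexHullThreshold.exists_innerRadius` / `exists_outerRadius`, p473071, + the norm group `‖ϖ‖^ℤ` of a norm uniformiser);
  `exists_differentOrd_eq_natCast_div` — `d_K = D/e` for some `D : ℕ` (abc-iut-S1's `exists_different_eq_maximalIdeal_pow`).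
* §2 **`cellSlack_diag_nonneg_iff_licence_all`** — THE SIGN LAW WITH NO BINDER: at every `p`-adic field, every prime `p`, every tie
  pattern, `0 ≤ slack ⟺ ι_{b'}(t_q)·(R_I)^∼ ⊆ hull(⋃_{g∈Ind2} g·ι_b(x_b)·(R_I)^∼)` (part 3's `cellSlack_diag_nonneg_iff_licence` with §1 plugged
  in): the sign of the diagonal cell slack IS the summand's (xi-f) licence inclusion, unconditionally in the lattice data.
* §3 **`cellSlack_diag_closedForm`** — at a TIE-FREE place `(p−1) ∤ e` with turning point `a₀` of `e` (`p^a(p−1) < e` for `a < a₀`,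
  `e ≤ p^{a₀}(p−1)`; strict automatically) and different exponent `D`:
  `slack = ((m_q − e·⌊(M − (|I|−1)·D − |I|·(⌊e/(p−1)⌋+1))/e⌋ − |I|·(p^{a₀} − e·a₀))/e)·log p`
  (part 3's `cellSlack_diag_orders` with abc-iut-w5-d180's witnesses `exists_shellRadii_witnesses_of_not_dvd`, which package abc-iut-c312-3's
  closed forms `R_in = ⌊e/(p−1)⌋ + 1` (`LogEnvelope.innerRadius_hyps`, `UnitLogValuationSpectrum`) and `R_out = p^{a₀} − e·a₀ = min_a(p^a − a·e)`
  (`LogEnvelope.norm_eq_zpow_of_isMaxOn_logUnits`, `UnitLogMaxNorm`) — the outer radius IS the max-norm element `hdom` names);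
  `cellSlack_diag_closedForm_of_not_dvd_of_not_dvd` — if moreover `p ∤ e` then `D = e − 1` (`differentOrd_eq_of_not_dvd`) and the ONLY inputs
  are `(p, e, a₀, |I|, M, m_q)`.
* §4 `cellSlack_diag_nonneg_iff_closedForm` — `0 ≤ slack ⟺ e·⌊(M − (|I|−1)·D − |I|·(⌊e/(p−1)⌋+1))/e⌋ + |I|·(p^{a₀} − e·a₀) ≤ m_q` at a tie-free
  place: the closed integer predicate of abc-iut-w5-d180's `iota_smul_subset_packetHull_orbit_iff_orders_of_not_dvd`, now read as the SIGN
  of an exact log-volume difference.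

HONEST SCOPE (numbers, not adjectives). (i) The VALUE formulas (§3–§4) need `(p−1) ∤ e`: at `(p−1) ∣ e` (on the genuine bed: `p = 7` with
`6 ∣ e_w`, `p = 3` with `2 ∣ e_w`, `p = 5` with `4 ∣ e_w`) the inner radius is `K`-dependent and only `R_in ≥ ⌊e/(p−1)⌋ + 1`
(`LogEnvelope.closedBall_div_succ_subset_logUnits`) and `R_out ≤`-envelope (`LogEnvelope.forall_mem_logUnits_norm_le_envelope`) are
theorems; the SIGN law §2 holds there regardless. (ii) One diagonal packet of one field; which genuine completion carries which `(e, D)`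
(`differentOrd_rescaledCompletion_eq`) and the Galois descent of a packet sum to places (`Cor312ThetaSideGaloisDescent`) are not re-done
here. Nothing here decides any cell at genuine data, asserts or denies Cor. 3.12, or bears on abc. [claim: Mochizuki2012, status: disputed]
for every quoted construction; [cite: DupuyHilado2025, §3.7, §4.9, §4.12]; [cite: Mochizuki2012, IUTchIV Prop. 1.1 p. 9, Prop. 1.2 (i)(ii)
p. 10, Prop. 1.4 (iii) p. 13–14]; [cite: NeukirchANT1999, Ch. II (5.5)]; [cite: SerreLocalFields1979, Ch. III §6 Prop. 13]. Axioms: standard.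
-/

noncomputable section

open Set Function
open scoped Pointwise

namespace Summit.ABC.IUTFork.Repair.RHCellSlackExactOrdersClosedForm

open Literature.IUT.LogVolume Literature.NumberTheory.GaloisRepresentations.Ultrametric Summit.ABC.IUTFork.Cor312Vol
  Summit.ABC.IUTFork.Repair.RHCellSlackExactOrders Summit.ABC.IUTFork.Conditional

variable (p : ℕ) [Fact p.Prime] {I : Type} [Fintype I] [DecidableEq I] [Nonempty I]
  {K : Type} [NontriviallyNormedField K] [NormedAlgebra ℚ_[p] K] [IsUltrametricDist K] [ProperSpace K]

/-! ## §1. The six lattice binders of part 3 are inhabited at every `p`-adic field -/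

include p in
/-- **The radii binders are INHABITED at every `p`-adic field**: for a norm uniformiser `ϖ` there are `c_in, c_out ∈ K` and integers
`R_in, R_out` with `c_in·𝒪 ⊆ log_p(𝒪^×)` maximally (`hin`/`hmax`), `c_out ∈ log_p(𝒪^×)` of largest norm (`houtΛ`/`hdom`),
`‖c_in‖ = ‖ϖ‖^{R_in}`, `‖c_out‖ = ‖ϖ‖^{R_out}` — this lineage's `HexHullThreshold.exists_innerRadius` / `exists_outerRadius` (compactness and
openness of `log_p(𝒪^×)`) and the norm group `‖ϖ‖^ℤ`. [cite: Mochizuki2012, IUTchIV Prop. 1.2 (i) p. 10] [claim: Mochizuki2012, status: disputed] -/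
theorem exists_radii_binders {ϖ : Kˣ} (hϖ : IsUniformizer ϖ) :
    ∃ (cin cout : K) (Rin Rout : ℤ),
      (∀ o : K, ‖o‖ ≤ 1 → cin * o ∈ logUnits K) ∧
      (∃ (ϖ' : Kˣ) (w : K), IsUniformizer ϖ' ∧ w ∉ logUnits K ∧ ‖w‖ * ‖(ϖ' : K)‖ ≤ ‖cin‖) ∧
      cout ∈ logUnits K ∧ (∀ z ∈ logUnits K, ‖z‖ ≤ ‖cout‖) ∧
      ‖cin‖ = ‖(ϖ : K)‖ ^ Rin ∧ ‖cout‖ = ‖(ϖ : K)‖ ^ Rout := by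
  obtain ⟨cin, ϖ₁, w, hcin0, hin, hϖ₁, hw, hle⟩ := HexHullThreshold.exists_innerRadius p K
  obtain ⟨cout, houtΛ, hcout0, hdom⟩ := HexHullThreshold.exists_outerRadius p K
  obtain ⟨Rin, hRin⟩ := hϖ.2 (Units.mk0 cin hcin0)
  obtain ⟨Rout, hRout⟩ := hϖ.2 (Units.mk0 cout hcout0)
  rw [Units.val_mk0] at hRin hRout
  exact ⟨cin, cout, Rin, Rout, hin, ⟨ϖ₁, w, hϖ₁, hw, hle⟩, houtΛ, hdom, hRin, hRout⟩

/-- **`d_K = D/e` for some natural number `D`** (the different is `𝔪^D`; abc-iut-S1's `exists_different_eq_maximalIdeal_pow`) — the binder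
`hD` of part 3 is inhabited at every `p`-adic field. [cite: Mochizuki2012, IUTchIV Prop. 1.1 p. 9] [claim: Mochizuki2012, status: disputed] -/
theorem exists_differentOrd_eq_natCast_div :
    ∃ D : ℕ, differentOrd p K = (D : ℝ) / absRamificationIdx p K := by
  obtain ⟨D, -, hD⟩ := exists_different_eq_maximalIdeal_pow p K
  exact ⟨D, hD⟩

/-! ## §2. The SIGN law with no binder: `0 ≤ slack ⟺` the summand's (xi-f) licence inclusion, at every place -/

/-- **THE SIGN OF THE DIAGONAL CELL SLACK IS THE LICENCE CELL — AT EVERY `p`-ADIC FIELD, NO LATTICE INPUT.** For a norm uniformiser `ϖ`,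
Θ-slot scalars `x_a` all of norm `‖ϖ‖^M`, and `‖t_q‖ = ‖ϖ‖^{m_q}`:
`0 ≤ log μ̄(hull(⋃_{g∈Ind2} g·⋃_a ι_a(x_a)·(R_I)^∼)) − log μ̄(ι_{b'}(t_q)·(R_I)^∼) ⟺ ι_{b'}(t_q)·(R_I)^∼ ⊆ hull(⋃_{g∈Ind2} g·ι_b(x_b)·(R_I)^∼)` —
part 3's `cellSlack_diag_nonneg_iff_licence` with its six radius/different binders DISCHARGED by §1 (ties `(p−1) ∣ e` included: the sign law
does not need the closed forms). «Room, not membership only», unconditionally in the lattice data.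
[cite: DupuyHilado2025, §4.9, §4.12] [cite: Mochizuki2012, IUTchIV Prop. 1.1 p. 9, Prop. 1.2 (i)(ii) p. 10] [claim: Mochizuki2012, status: disputed] -/
theorem cellSlack_diag_nonneg_iff_licence_all {ϖ : Kˣ} (hϖ : IsUniformizer ϖ)
    {x : I → K} {M : ℤ} (hx : ∀ a, ‖x a‖ = ‖(ϖ : K)‖ ^ M) (b b' : I) {tq : K} {mq : ℤ} (hq : ‖tq‖ = ‖(ϖ : K)‖ ^ mq) :
    0 ≤ packetLogμ p (fun _ : I => K) (packetHull p (fun _ : I => K) (⋃ g : indTwo p (fun _ : I => K),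
            g • ⋃ a, iota p (fun _ : I => K) a (x a) • (normalizedPacket p (fun _ : I => K) : Set (PacketAlgebra p (fun _ : I => K))))) -
          packetLogμ p (fun _ : I => K)
            (iota p (fun _ : I => K) b' tq • (normalizedPacket p (fun _ : I => K) : Set (PacketAlgebra p (fun _ : I => K)))) ↔
      iota p (fun _ : I => K) b' tq • (normalizedPacket p (fun _ : I => K) : Set (PacketAlgebra p (fun _ : I => K))) ⊆
        packetHull p (fun _ : I => K) (⋃ g : indTwo p (fun _ : I => K),
          g • (iota p (fun _ : I => K) b (x b) • (normalizedPacket p (fun _ : I => K) : Set (PacketAlgebra p (fun _ : I => K))))) := by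
  obtain ⟨cin, cout, Rin, Rout, hin, hmax, houtΛ, hdom, hRin, hRout⟩ := exists_radii_binders p hϖ
  obtain ⟨D, hD⟩ := exists_differentOrd_eq_natCast_div p (K := K)
  exact cellSlack_diag_nonneg_iff_licence p hϖ hD hin hmax houtΛ hdom hRin hRout hx b b' hq

/-! ## §3. The VALUE of the slack in closed form at a tie-free place `(p−1) ∤ e` -/

/-- **THE DIAGONAL CELL SLACK IN CLOSED FORM AT A TIE-FREE PLACE.** `(p−1) ∤ e = e(K/ℚ_p)`, norm uniformiser `ϖ`, different exponent `D`
(`d_K = D/e`), turning point `a₀` of `e` (`p^a(p−1) < e` for `a < a₀`, `e ≤ p^{a₀}(p−1)`), Θ-slot scalars all of norm `‖ϖ‖^M`,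
`‖t_q‖ = ‖ϖ‖^{m_q}`. Then
`log μ̄(hull(⋃_{g∈Ind2} g·⋃_a ι_a(x_a)·(R_I)^∼)) − log μ̄(ι_{b'}(t_q)·(R_I)^∼) = ((m_q − e·⌊(M − (|I|−1)·D − |I|·R_in)/e⌋ − |I|·R_out)/e)·log p`
with `R_in = ⌊e/(p−1)⌋ + 1` and `R_out = p^{a₀} − e·a₀` SUBSTITUTED — part 3's `cellSlack_diag_orders` at abc-iut-w5-d180's witnesses
`exists_shellRadii_witnesses_of_not_dvd` (abc-iut-c312-3's `innerRadius_hyps` and `norm_eq_zpow_of_isMaxOn_logUnits`: the binder `c_out` that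
`hdom` names HAS norm `‖ϖ‖^{min_a (p^a − a·e)}`). No radius binder is left.
[cite: NeukirchANT1999, Ch. II (5.5)] [cite: DupuyHilado2025, §3.7, §4.9, §4.12] [cite: Mochizuki2012, IUTchIV Prop. 1.2 (i)(ii) p. 10, Prop. 1.4 (iii) p. 13–14]
[claim: Mochizuki2012, status: disputed] -/
theorem cellSlack_diag_closedForm (hnd : ¬ (p - 1) ∣ absRamificationIdx p K) {ϖ : Kˣ} (hϖ : IsUniformizer ϖ) {D : ℕ}
    (hD : differentOrd p K = (D : ℝ) / absRamificationIdx p K)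
    {a₀ : ℕ} (hlo : ∀ a < a₀, (p : ℤ) ^ a * ((p : ℤ) - 1) < absRamificationIdx p K)
    (hhi : (absRamificationIdx p K : ℤ) ≤ (p : ℤ) ^ a₀ * ((p : ℤ) - 1))
    {x : I → K} {M : ℤ} (hx : ∀ a, ‖x a‖ = ‖(ϖ : K)‖ ^ M) (b' : I) {tq : K} {mq : ℤ} (hq : ‖tq‖ = ‖(ϖ : K)‖ ^ mq) :
    packetLogμ p (fun _ : I => K) (packetHull p (fun _ : I => K) (⋃ g : indTwo p (fun _ : I => K),
          g • ⋃ a, iota p (fun _ : I => K) a (x a) • (normalizedPacket p (fun _ : I => K) : Set (PacketAlgebra p (fun _ : I => K))))) -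
        packetLogμ p (fun _ : I => K)
          (iota p (fun _ : I => K) b' tq • (normalizedPacket p (fun _ : I => K) : Set (PacketAlgebra p (fun _ : I => K)))) =
      ((mq - (absRamificationIdx p K : ℤ) *
              ((M - (Fintype.card I - 1 : ℕ) * (D : ℤ) -
                  Fintype.card I * ((((absRamificationIdx p K / (p - 1) : ℕ) : ℤ) + 1))) / absRamificationIdx p K) -
            Fintype.card I * ((p : ℤ) ^ a₀ - (absRamificationIdx p K : ℤ) * (a₀ : ℤ)) : ℤ) : ℝ) /
          absRamificationIdx p K * Real.log p := by
  obtain ⟨cin, cout, hin, hmax, houtΛ, hdom, hRin, hRout⟩ := exists_shellRadii_witnesses_of_not_dvd p hnd hϖ hlo hhi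
  exact cellSlack_diag_orders p hϖ hD hin hmax houtΛ hdom hRin hRout hx b' hq

/-- `p ∤ e ⇒ d_K = (e − 1)/e` with the numerator a NATURAL number (`differentOrd_eq_of_not_dvd`, cast bookkeeping).
[cite: SerreLocalFields1979, Ch. III §6 Prop. 13] -/
theorem differentOrd_eq_natCast_sub_one_div (hpe : ¬ p ∣ absRamificationIdx p K) :
    differentOrd p K = (((absRamificationIdx p K - 1 : ℕ) : ℕ) : ℝ) / absRamificationIdx p K := by
  rw [differentOrd_eq_of_not_dvd p K hpe, Nat.cast_sub (absRamificationIdx_pos p K), Nat.cast_one]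

/-- **The same with `p ∤ e` as well (`D = e − 1`): the ONLY inputs are `(p, e, a₀, |I|, M, m_q)`.** At a place with `(p−1) ∤ e` and
`p ∤ e` (classically tame but possibly deep, `e ≥ p` allowed):
`slack = ((m_q − e·⌊(M − (|I|−1)·(e−1) − |I|·(⌊e/(p−1)⌋+1))/e⌋ − |I|·(p^{a₀} − e·a₀))/e)·log p`.
[cite: NeukirchANT1999, Ch. II (5.5)] [cite: SerreLocalFields1979, Ch. III §6 Prop. 13] [cite: DupuyHilado2025, §4.9, §4.12] [claim: Mochizuki2012, status: disputed] -/
theorem cellSlack_diag_closedForm_of_not_dvd_of_not_dvd (hnd : ¬ (p - 1) ∣ absRamificationIdx p K)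
    (hpe : ¬ p ∣ absRamificationIdx p K) {ϖ : Kˣ} (hϖ : IsUniformizer ϖ)
    {a₀ : ℕ} (hlo : ∀ a < a₀, (p : ℤ) ^ a * ((p : ℤ) - 1) < absRamificationIdx p K)
    (hhi : (absRamificationIdx p K : ℤ) ≤ (p : ℤ) ^ a₀ * ((p : ℤ) - 1))
    {x : I → K} {M : ℤ} (hx : ∀ a, ‖x a‖ = ‖(ϖ : K)‖ ^ M) (b' : I) {tq : K} {mq : ℤ} (hq : ‖tq‖ = ‖(ϖ : K)‖ ^ mq) :
    packetLogμ p (fun _ : I => K) (packetHull p (fun _ : I => K) (⋃ g : indTwo p (fun _ : I => K),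
          g • ⋃ a, iota p (fun _ : I => K) a (x a) • (normalizedPacket p (fun _ : I => K) : Set (PacketAlgebra p (fun _ : I => K))))) -
        packetLogμ p (fun _ : I => K)
          (iota p (fun _ : I => K) b' tq • (normalizedPacket p (fun _ : I => K) : Set (PacketAlgebra p (fun _ : I => K)))) =
      ((mq - (absRamificationIdx p K : ℤ) *
              ((M - (Fintype.card I - 1 : ℕ) * ((absRamificationIdx p K - 1 : ℕ) : ℤ) -
                  Fintype.card I * ((((absRamificationIdx p K / (p - 1) : ℕ) : ℤ) + 1))) / absRamificationIdx p K) -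
            Fintype.card I * ((p : ℤ) ^ a₀ - (absRamificationIdx p K : ℤ) * (a₀ : ℤ)) : ℤ) : ℝ) /
          absRamificationIdx p K * Real.log p :=
  cellSlack_diag_closedForm p hnd hϖ (differentOrd_eq_natCast_sub_one_div p hpe) hlo hhi hx b' hq

/-! ## §4. The sign of the slack at a tie-free place: the closed integer predicate -/

/-- **`0 ≤ slack ⟺ e·⌊(M − (|I|−1)·D − |I|·(⌊e/(p−1)⌋+1))/e⌋ + |I|·(p^{a₀} − e·a₀) ≤ m_q`** at a tie-free place `(p−1) ∤ e` — part 3's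
`cellSlack_diag_nonneg_iff_orders` at the witnesses; the right-hand side is the closed cell of abc-iut-w5-d180's
`iota_smul_subset_packetHull_orbit_iff_orders_of_not_dvd`, here read as the SIGN of an exact log-volume difference.
[cite: NeukirchANT1999, Ch. II (5.5)] [cite: DupuyHilado2025, §4.9, §4.12] [claim: Mochizuki2012, status: disputed] -/
theorem cellSlack_diag_nonneg_iff_closedForm (hnd : ¬ (p - 1) ∣ absRamificationIdx p K) {ϖ : Kˣ} (hϖ : IsUniformizer ϖ) {D : ℕ}
    (hD : differentOrd p K = (D : ℝ) / absRamificationIdx p K)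
    {a₀ : ℕ} (hlo : ∀ a < a₀, (p : ℤ) ^ a * ((p : ℤ) - 1) < absRamificationIdx p K)
    (hhi : (absRamificationIdx p K : ℤ) ≤ (p : ℤ) ^ a₀ * ((p : ℤ) - 1))
    {x : I → K} {M : ℤ} (hx : ∀ a, ‖x a‖ = ‖(ϖ : K)‖ ^ M) (b' : I) {tq : K} {mq : ℤ} (hq : ‖tq‖ = ‖(ϖ : K)‖ ^ mq) :
    0 ≤ packetLogμ p (fun _ : I => K) (packetHull p (fun _ : I => K) (⋃ g : indTwo p (fun _ : I => K),
            g • ⋃ a, iota p (fun _ : I => K) a (x a) • (normalizedPacket p (fun _ : I => K) : Set (PacketAlgebra p (fun _ : I => K))))) -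
          packetLogμ p (fun _ : I => K)
            (iota p (fun _ : I => K) b' tq • (normalizedPacket p (fun _ : I => K) : Set (PacketAlgebra p (fun _ : I => K)))) ↔
      (absRamificationIdx p K : ℤ) *
            ((M - (Fintype.card I - 1 : ℕ) * (D : ℤ) -
                Fintype.card I * ((((absRamificationIdx p K / (p - 1) : ℕ) : ℤ) + 1))) / absRamificationIdx p K) +
          Fintype.card I * ((p : ℤ) ^ a₀ - (absRamificationIdx p K : ℤ) * (a₀ : ℤ)) ≤ mq := by
  obtain ⟨cin, cout, hin, hmax, houtΛ, hdom, hRin, hRout⟩ := exists_shellRadii_witnesses_of_not_dvd p hnd hϖ hlo hhi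
  exact cellSlack_diag_nonneg_iff_orders p hϖ hD hin hmax houtΛ hdom hRin hRout hx b' hq

end Summit.ABC.IUTFork.Repair.RHCellSlackExactOrdersClosedForm

end
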